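import Mathlib.Analysis.SpecialFunctions.Trigonometric.Arctan
import Mathlib.Analysis.Complex.Trigonometric
import Literature.NumberTheory.Transcendental.KZPeriodsProofs
import Summits.KontsevichZagierPeriods.KontsevichZagierPeriods.Theorems.HurwitzMicroSectorsNormalFormPrincipleAlgBaker

/-!
# `NormalFormPrinciple` (stmt-KontsevichZagierPeriods-3869), line `SketchIdeator1` —
# the leaf `stub_boxRigidity` in dimension one — lattice bases and algebraicity for the arctangent layer

Pure proof file (lead seat c3; `--supports` the crux). Arithmetic side facts for the arctangent
layer: a positive `ℤ`-basis of a finitely generated lattice of reals with both coordinate systems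
(`exists_latticeBasis`); `e^{2i·arctan t} = (1+it)/(1−it)` and its algebraicity; `tan θ` is algebraic when `e^{iθ}` is; `e^{iθ/M}` is algebraic
when `e^{iθ}` is. The mixed Baker endgame `eq_zero_of_alg_logs_angles_eq_zero` is the sibling file
`…AngBakerK4`.

Sources: A. Baker, *Transcendental Number Theory* (1975), Thm. 2.1 (context). No definitions are introduced.
-/

noncomputable section

open Finset Complex

namespace Summit.KontsevichZagierPeriods.HurwitzMicroSectors.NormalFormPrinciple.PiBox

namespace Dlog

/-! ## A positive `ℤ`-basis of a finitely generated lattice of reals -/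

/-- **A positive `ℤ`-basis of `Σⱼ ℤ vⱼ ⊂ ℝ`** with both coordinate systems and `ℚ`-independence
(free because torsion-free; signs adjusted). [folklore] -/
theorem exists_latticeBasis {k : ℕ} (v : Fin k → ℝ) :
    ∃ (s : ℕ) (f : Fin s → ℝ) (n : Fin k → Fin s → ℤ) (m : Fin s → Fin k → ℤ),
      (∀ i, 0 < f i) ∧ LinearIndependent ℚ f ∧ (∀ j, v j = ∑ i, (n j i : ℝ) * f i) ∧
      ∀ i, f i = ∑ j, (m i j : ℝ) * v j := by
  classical
  set M : Submodule ℤ ℝ := Submodule.span ℤ (Set.range v) with hM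
  haveI : Module.Finite ℤ M := Module.Finite.span_of_finite ℤ (Set.finite_range v)
  haveI : Module.Free ℤ M := Module.free_of_finite_type_torsion_free'
  let b := Module.Free.chooseBasis ℤ M
  let ι := Module.Free.ChooseBasisIndex ℤ M
  have hb0 : ∀ i, (b i : ℝ) ≠ 0 := fun i h => b.ne_zero i (Subtype.ext h)
  have hliZ : LinearIndependent ℤ (fun i => (b i : ℝ)) :=
    b.linearIndependent.map' M.subtype (Submodule.ker_subtype M)
  let w : ι → ℤˣ := fun i => if 0 < (b i : ℝ) then 1 else -1
  have hwsq : ∀ i, ((w i : ℤ) : ℝ) * ((w i : ℤ) : ℝ) = 1 := by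
    intro i; by_cases h : 0 < (b i : ℝ) <;> simp [w, h]
  have habs : ∀ i, |(b i : ℝ)| = ((w i : ℤ) : ℝ) * (b i : ℝ) := by
    intro i
    by_cases h : 0 < (b i : ℝ)
    · simp [w, h, abs_of_pos h]
    · have h' : (b i : ℝ) < 0 := lt_of_le_of_ne (not_lt.mp h) (hb0 i)
      simp [w, h, abs_of_neg h']
  have hliZ' : LinearIndependent ℤ (fun i => |(b i : ℝ)|) := by
    have h := hliZ.units_smul w
    convert h using 1
    funext i
    rw [habs i, Pi.smul_apply', Units.smul_def, zsmul_eq_mul]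
  have hliQ : LinearIndependent ℚ (fun i => |(b i : ℝ)|) :=
    (LinearIndependent.iff_fractionRing ℤ ℚ).mp hliZ'
  -- both coordinate systems
  have hmem : ∀ i, ∃ m : Fin k → ℤ, (b i : ℝ) = ∑ j, (m j : ℝ) * v j := by
    intro i
    have h : (b i : ℝ) ∈ Submodule.span ℤ (Set.range v) := (b i).2
    rw [Submodule.mem_span_range_iff_exists_fun] at h
    obtain ⟨m, hm⟩ := h
    exact ⟨m, by rw [← hm]; exact Finset.sum_congr rfl fun j _ => by rw [zsmul_eq_mul]⟩
  choose mc hmc using hmem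
  have hcoord : ∀ j, v j =
      ∑ i, (((b.repr ⟨v j, Submodule.subset_span ⟨j, rfl⟩⟩ i : ℤ) * (w i : ℤ) : ℤ) : ℝ) * |(b i : ℝ)| := by
    intro j
    have h := b.sum_repr ⟨v j, Submodule.subset_span ⟨j, rfl⟩⟩
    have h' := congrArg (fun x : M => (x : ℝ)) h
    simp only [Submodule.coe_sum, Submodule.coe_smul_of_tower] at h'
    calc v j = ∑ x, (b.repr ⟨v j, Submodule.subset_span ⟨j, rfl⟩⟩ x) • ((b x : M) : ℝ) := h'.symm
      _ = _ := Finset.sum_congr rfl fun i _ => by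
        rw [habs i, zsmul_eq_mul]
        push_cast
        linear_combination -((b.repr ⟨v j, Submodule.subset_span ⟨j, rfl⟩⟩ i : ℤ) : ℝ) *
          (b i : ℝ) * hwsq i
  obtain ⟨s, ⟨eqv⟩⟩ : ∃ s, Nonempty (ι ≃ Fin s) := ⟨Fintype.card ι, ⟨Fintype.equivFin ι⟩⟩
  refine ⟨s, fun i => |(b (eqv.symm i) : ℝ)|,
    fun j i => (b.repr ⟨v j, Submodule.subset_span ⟨j, rfl⟩⟩ (eqv.symm i) : ℤ) * (w (eqv.symm i) : ℤ),
    fun i j => (w (eqv.symm i) : ℤ) * mc (eqv.symm i) j,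
    fun i => abs_pos.mpr (hb0 _), (linearIndependent_equiv eqv.symm).mpr hliQ, fun j => ?_, fun i => ?_⟩
  · rw [hcoord j, ← Equiv.sum_comp eqv.symm]
  · show |(b (eqv.symm i) : ℝ)| = ∑ j, (((w (eqv.symm i) : ℤ) * mc (eqv.symm i) j : ℤ) : ℝ) * v j
    rw [habs, hmc (eqv.symm i), Finset.mul_sum]
    refine Finset.sum_congr rfl fun j _ => ?_
    push_cast
    ring

/-! ## Algebraicity of the data attached to an algebraic tangent -/

/-- `e^{2i·arctan t} = (1 + it)/(1 − it)`. [folklore] -/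
theorem exp_two_arctan_mul_I (t : ℝ) :
    Complex.exp ((2 * Real.arctan t : ℝ) * I) = (1 + t * I) / (1 - t * I) := by
  have hcos : Real.cos (Real.arctan t) ≠ 0 := (Real.cos_arctan_pos t).ne'
  have hc : (Real.cos (Real.arctan t) : ℂ) ≠ 0 := by exact_mod_cast hcos
  -- `e^{iφ} = cos φ + i sin φ`, `tan φ = t`
  have h1 : Complex.exp ((Real.arctan t : ℝ) * I) =
      Real.cos (Real.arctan t) * (1 + t * I) := by
    rw [Complex.exp_mul_I, ← Complex.ofReal_cos, ← Complex.ofReal_sin]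
    have hs : Real.sin (Real.arctan t) = Real.cos (Real.arctan t) * t := by
      have := Real.tan_arctan t
      rw [Real.tan_eq_sin_div_cos] at this
      field_simp at this
      linarith
    rw [hs]
    push_cast
    ring
  have hden : (1 : ℂ) - t * I ≠ 0 := by
    intro h
    have := congrArg Complex.re h
    simp at this
  rw [show ((2 * Real.arctan t : ℝ) : ℂ) * I = (Real.arctan t : ℝ) * I + (Real.arctan t : ℝ) * I by
    push_cast; ring, Complex.exp_add, h1]
  rw [eq_div_iff hden]
  have hnorm : (Real.cos (Real.arctan t) : ℂ) ^ 2 * ((1 + t * I) * (1 - t * I)) = 1 := by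
    have hc2 : Real.cos (Real.arctan t) ^ 2 = 1 / (1 + t ^ 2) := by
      rw [Real.cos_arctan]; rw [div_pow, one_pow, Real.sq_sqrt (by positivity)]
    have : ((1 : ℂ) + t * I) * (1 - t * I) = (1 + t ^ 2 : ℝ) := by
      push_cast; ring_nf; rw [Complex.I_sq]; ring
    rw [this, ← Complex.ofReal_pow, hc2]
    push_cast
    exact one_div_mul_cancel (by exact_mod_cast (by positivity : (1 + t ^ 2 : ℝ) ≠ 0))
  linear_combination (1 + (t:ℂ) * I) * hnorm

/-- `e^{2i·arctan t}` is algebraic for real algebraic `t`. [folklore] -/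
theorem isAlgebraic_exp_two_arctan_mul_I {t : ℝ} (ht : IsAlgebraic ℚ t) :
    IsAlgebraic ℚ (Complex.exp ((2 * Real.arctan t : ℝ) * I)) := by
  rw [exp_two_arctan_mul_I]
  have htC : IsAlgebraic ℚ (t : ℂ) :=
    (isAlgebraic_algebraMap_iff (R := ℚ) (A := ℂ) Complex.ofReal_injective).mpr ht
  have hI : IsAlgebraic ℚ I := ⟨Polynomial.X ^ 2 + 1, by
    intro h; have := congrArg (Polynomial.eval 0) h; simp at this, by simp⟩
  rw [div_eq_mul_inv]
  exact (isAlgebraic_one.add (htC.mul hI)).mul (isAlgebraic_one.sub (htC.mul hI)).inv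

/-- If `e^{iθ}` is algebraic then `tan θ = sin θ / cos θ` is algebraic. [folklore] -/
theorem isAlgebraic_tan_of_exp {θ : ℝ} (h : IsAlgebraic ℚ (Complex.exp ((θ:ℂ) * I))) :
    IsAlgebraic ℚ (Real.tan θ) := by
  obtain ⟨hre, him⟩ := Literature.NumberTheory.Transcendental.isAlgebraic_re_im h
  rw [Complex.exp_ofReal_mul_I_re] at hre
  rw [Complex.exp_ofReal_mul_I_im] at him
  rw [Real.tan_eq_sin_div_cos, div_eq_mul_inv]
  exact him.mul hre.inv

/-- Roots of algebraic numbers: if `e^{iθ}` is algebraic then so is `e^{iθ/M}` (`M ≥ 1`). [folklore] -/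
theorem isAlgebraic_exp_div_nat {θ : ℝ} (h : IsAlgebraic ℚ (Complex.exp ((θ:ℂ) * I))) {M : ℕ}
    (hM : 0 < M) : IsAlgebraic ℚ (Complex.exp (((θ / M : ℝ) : ℂ) * I)) := by
  refine IsAlgebraic.of_pow hM ?_
  rw [← Complex.exp_nat_mul]
  have : (M:ℂ) * (((θ / M : ℝ) : ℂ) * I) = (θ:ℂ) * I := by
    have hM' : (M:ℂ) ≠ 0 := by exact_mod_cast hM.ne'
    push_cast
    field_simp
  rw [this]
  exact h

end Dlog

end Summit.KontsevichZagierPeriods.HurwitzMicroSectors.NormalFormPrinciple.PiBox
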